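import Mathlib
import Literature.NumberTheory.Irrationality.DirichletLValues.ChowlaMilnorSpaceProofs
import HarnessLib

/-!
# Rational combinations of the numbers `Z_k(a,q)` (even `k`): Gun–Murty–Rath's Proposition 2 and Corollary 2

Topic `Literature/NumberTheory/Irrationality/DirichletLValues`. Fifth proofs-only file on the UNCONDITIONAL part of
S. Gun, M. R. Murty, P. Rath, *On a conjecture of Chowla and Milnor*, Canad. J. Math. **63** (2011) 1328–1344
[GunRammurtyRath2011] (pp. 1335–1336), after `ChowlaMilnorSpaceProofs.lean` (whose coprime sum
`Σ_{(a,q)=1} ζ(k, a/q) = J_k(q)·ζ(k)` is reused) and the tree's Okada files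
(`Transcendental/OkadaHurwitzBernoulliProofs.lean`, `OkadaLinearIndependenceProofs.lean`). Read on the page:

* **Proposition 2** (p. 1335). "Let `k > 1` be an even integer. For `q ≥ 3`, let
  `Z_k(a, q) := (ζ(k, a/q) + ζ(k, 1 − a/q))/(2πi)^k` for any `(a, q) = 1` and `1 ≤ a < q/2`. If `φ(q) ≥ 4`, then the
  `Z_k(a, q)`'s are all irrational real numbers lying in `ℚ(ζ_q)`. Further, `Σ_{a=1, (a,q)=1}^{q/2} c_a Z_k(a, q) ∈ ℚ`,
  `c_a ∈ ℚ` if and only if all the `c_a`'s are equal." Proof (p. 1336): "`(ℤ/qℤ)^×/±1` acts transitively … linearly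
  independent over `ℚ` … The converse is also true as `Σ_{(a,q)=1} ζ(k, a/q)` is a rational multiple of `ζ(k)`."
  (Corollary 2, on `L(k, χ)/π^k` for even quadratic `χ`, is left to a sequel.)

## What is proved (theorems only; no definition is introduced)

For even `k`, `(2πi)^k = (−4)^{k/2} π^k`, so "`∈ ℚ·(2πi)^k`" and "`∈ ℚ·π^k`" agree; statements use `π^k`, the real
Hurwitz values `hurwitzValue` of `LinearIndependence.lean`, and the half-system as the `Finset`
`(Finset.range q).filter (fun a => 2 * a < q ∧ Nat.Coprime a q)`.
* `relation_transport_const` — a rational relation WITH CONSTANT TERM `Σ_i c_i (ζ(k, v_i/q) + (−1)^k ζ(k, −v_i/q))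
  = α·(2πi)^k` transports to every twist `v_i ↦ v_i t`, `(t, q) = 1` (a rational polynomial relation at `e^{2πi/q}` by
  the Okada file's Bernoulli–Fourier identity; the tree's `Okada.relation_transport` is the case `α = 0`);
* `sum_coprime_eq_sum_halfSystem`, `sum_halfSystem_hurwitz_symm`, `exists_rat_sum_halfSystem_eq_mul_two_pi_I_pow` — the
  pairing `a ↔ q − a`, the total `Σ_{half-system} (ζ(k,a/q) + ζ(k,1−a/q)) = J_k(q)·ζ(k)`, `= β·(2πi)^k` with `β ∈ ℚ^×`
  for even `k` (Euler, tree `riemannZeta_two_mul_nat_mem_ratCast_mul_pi_pow`);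
* `halfSystem_coeff_eq_const`, **`sum_halfSystem_smul_mem_rat_iff`** — PROPOSITION 2, second part;
  **`irrational_hurwitz_symm_div_pi_pow`** — PROPOSITION 2, first part (membership in `ℚ(ζ_q)` is
  `ChowlaMilnorEvenProofs.hurwitzEven_mem_cyclotomic`).

HONEST FRAMING (cells pub-zeta5 / zeta5-irr): kernel theorems of PRINTED, UNCONDITIONAL statements; net named-fact
debt 0; the Chowla–Milnor conjecture stays OPEN and untyped; nothing here concerns `ζ(5)`.
-/

noncomputable section

open Finset Complex Polynomial HurwitzZeta

open scoped Nat

namespace Literature.NumberTheory.Irrationality.DirichletLValues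

open Literature.NumberTheory.Transcendental

/-! ### Transport of a rational relation with constant term -/

/-- If a rational polynomial vanishes at `ζ_q = e^{2πi/q}` then it vanishes at `ζ_q^t` for `(t, q) = 1` (both have
minimal polynomial `Φ_q`; Mathlib `cyclotomic_eq_minpoly_rat`). [folklore] -/
private theorem aeval_pow_eq_zero_of_aeval_eq_zero {q : ℕ} (hq : q ≠ 0) {P : ℚ[X]}
    (hP : aeval (Complex.exp (2 * Real.pi * I / q)) P = 0) {t : ℕ} (ht : t.Coprime q) :
    aeval (Complex.exp (2 * Real.pi * I / q) ^ t) P = 0 := by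
  have hζ := Complex.isPrimitiveRoot_exp q hq
  have hζt := hζ.pow_of_coprime t ht
  have hpos : 0 < q := Nat.pos_of_ne_zero hq
  have hdvd : minpoly ℚ (Complex.exp (2 * Real.pi * I / q) ^ t) ∣ P := by
    rw [← Polynomial.cyclotomic_eq_minpoly_rat hζt hpos, Polynomial.cyclotomic_eq_minpoly_rat hζ hpos]
    exact minpoly.dvd ℚ _ hP
  obtain ⟨Q, hQ⟩ := hdvd
  rw [hQ, map_mul, minpoly.aeval, zero_mul]

/-- **Transport of a rational relation with constant term.** If rational numbers `c_i`, `α` and residues `v_i` mod `q`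
satisfy `Σ_i c_i (ζ(k, v_i/q) + (−1)^k ζ(k, −v_i/q)) = α (2πi)^k` (`k ≥ 2`), then the same holds with every `v_i`
replaced by `v_i t`, `(t, q) = 1`: by the Bernoulli–Fourier identity `Okada.hurwitz_symm_eq_bernoulli_sum` the relation
reads `P(ζ_q) = 0` for a polynomial `P ∈ ℚ[X]` (the constant `α` included), and `P(ζ_q^t) = 0` is the twisted relation
("`σ_c(Z_k(a,q)) = Z_k(ac,q)`", p. 1334; the case `α = 0` is the tree's `Okada.relation_transport`).
[cite: GunRammurtyRath2011, proof of Proposition 1 (p. 1334) and of Proposition 2 (p. 1336)] -/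
theorem relation_transport_const {q : ℕ} [NeZero q] {k : ℕ} (hk : 2 ≤ k) {ι : Type*} (S : Finset ι) (c : ι → ℚ)
    (v : ι → ZMod q) (α : ℚ)
    (h : ∑ i ∈ S, (c i : ℂ) * (hurwitzZeta (ZMod.toAddCircle (v i)) k +
        (-1 : ℂ) ^ k * hurwitzZeta (ZMod.toAddCircle (-(v i))) k) = (α : ℂ) * (2 * Real.pi * I) ^ k)
    {t : ℕ} (ht : t.Coprime q) :
    ∑ i ∈ S, (c i : ℂ) * (hurwitzZeta (ZMod.toAddCircle (v i * (t : ZMod q))) k +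
        (-1 : ℂ) ^ k * hurwitzZeta (ZMod.toAddCircle (-(v i * (t : ZMod q)))) k) = (α : ℂ) * (2 * Real.pi * I) ^ k := by
  have hq0 : (q : ℂ) ≠ 0 := by exact_mod_cast NeZero.ne q
  have hK : (q : ℂ) ^ (k - 1) * (-(2 * Real.pi * I) ^ k / k !) ≠ 0 := by
    have h2 : (2 * Real.pi * I : ℂ) ^ k ≠ 0 := pow_ne_zero _ Complex.two_pi_I_ne_zero
    have h3 : (k ! : ℂ) ≠ 0 := by exact_mod_cast Nat.factorial_ne_zero k
    exact mul_ne_zero (pow_ne_zero _ hq0) (div_ne_zero (neg_ne_zero.mpr h2) h3)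
  -- the polynomial `P = Σ_i c_i P_{v_i} + C (α k!/q^{k-1})`, so that `P(ζ_q^t) · K = Σ_i c_i HS(v_i t) − α (2πi)^k`
  set P : ℚ[X] := (∑ i ∈ S, C (c i) *
    ∑ j : ZMod q, C ((Polynomial.bernoulli k).eval ((j.val : ℚ) / q)) * X ^ (-(j * v i)).val) +
      C (α * k ! / (q : ℚ) ^ (k - 1)) with hPdef
  have hPeval : ∀ t : ℕ, aeval (Complex.exp (2 * Real.pi * I / q) ^ t) P *
      ((q : ℂ) ^ (k - 1) * (-(2 * Real.pi * I) ^ k / k !)) =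
      (∑ i ∈ S, (c i : ℂ) * (hurwitzZeta (ZMod.toAddCircle (v i * (t : ZMod q))) k +
        (-1 : ℂ) ^ k * hurwitzZeta (ZMod.toAddCircle (-(v i * (t : ZMod q)))) k)) -
        (α : ℂ) * (2 * Real.pi * I) ^ k := by
    intro t
    rw [hPdef, map_add, map_sum, add_mul, Finset.sum_mul]
    have hmain : ∀ i ∈ S, aeval (Complex.exp (2 * Real.pi * I / q) ^ t) (C (c i) *
        ∑ j : ZMod q, C ((Polynomial.bernoulli k).eval ((j.val : ℚ) / q)) * X ^ (-(j * v i)).val) *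
        ((q : ℂ) ^ (k - 1) * (-(2 * Real.pi * I) ^ k / k !)) =
        (c i : ℂ) * (hurwitzZeta (ZMod.toAddCircle (v i * (t : ZMod q))) k +
          (-1 : ℂ) ^ k * hurwitzZeta (ZMod.toAddCircle (-(v i * (t : ZMod q)))) k) := by
      intro i _
      rw [map_mul, aeval_C, eq_ratCast, Okada.aeval_exp_pow_bernoulliPoly, Okada.hurwitz_symm_eq_bernoulli_sum hk]
      ring
    rw [Finset.sum_congr rfl hmain, aeval_C, eq_ratCast]
    have hk1 : (k ! : ℂ) ≠ 0 := by exact_mod_cast Nat.factorial_ne_zero k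
    push_cast
    field_simp
    ring
  have hP0 : aeval (Complex.exp (2 * Real.pi * I / q)) P = 0 := by
    have := hPeval 1
    simp only [pow_one, Nat.cast_one, mul_one] at this
    rw [h, sub_self] at this
    exact (mul_eq_zero.mp this).resolve_right hK
  have htw := hPeval t
  rw [aeval_pow_eq_zero_of_aeval_eq_zero (NeZero.ne q) hP0 ht, zero_mul] at htw
  linear_combination -htw

/-! ### The half-system total `Σ_a (ζ(k,a/q) + ζ(k,1−a/q)) = J_k(q) ζ(k)` -/

/-- **Pairing `a ↔ q − a`.** For `q ≥ 3` and any `F`,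
`Σ_{1 ≤ a ≤ q, (a,q)=1} F(a) = Σ_{1 ≤ a < q/2, (a,q)=1} (F(a) + F(q − a))` (no coprime residue has `2a = q`).
[cite: GunRammurtyRath2011, proof of Theorem 1 (p. 1332: the two spanning families)] -/
theorem sum_coprime_eq_sum_halfSystem {q : ℕ} (hq : 3 ≤ q) {M : Type*} [AddCommMonoid M] (F : ℕ → M) :
    ∑ a ∈ (Finset.Ioc 0 q).filter (fun a => a.Coprime q), F a =
      ∑ a ∈ (Finset.range q).filter (fun a => 2 * a < q ∧ a.Coprime q), (F a + F (q - a)) := by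
  rw [Finset.sum_add_distrib]
  -- split the coprime residues according to `2a < q` / `2a > q`
  have hsplit : (Finset.Ioc 0 q).filter (fun a => a.Coprime q) =
      (Finset.range q).filter (fun a => 2 * a < q ∧ a.Coprime q) ∪
        ((Finset.Ioc 0 q).filter (fun a => a.Coprime q)).filter (fun a => q < 2 * a) := by
    ext a
    simp only [Finset.mem_union, Finset.mem_filter, Finset.mem_Ioc, Finset.mem_range]
    constructor
    · rintro ⟨⟨ha0, haq⟩, hcop⟩
      rcases lt_trichotomy (2 * a) q with h | h | h
      · exact Or.inl ⟨by omega, h, hcop⟩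
      · exfalso
        have : a ∣ q := ⟨2, by omega⟩
        have := Nat.Coprime.eq_one_of_dvd hcop this
        omega
      · exact Or.inr ⟨⟨⟨ha0, haq⟩, hcop⟩, h⟩
    · rintro (⟨haq, h2, hcop⟩ | ⟨⟨⟨ha0, haq⟩, hcop⟩, h2⟩)
      · refine ⟨⟨?_, by omega⟩, hcop⟩
        rcases Nat.eq_zero_or_pos a with rfl | hpos
        · rw [Nat.coprime_zero_left] at hcop
          omega
        · exact hpos
      · exact ⟨⟨ha0, haq⟩, hcop⟩
  rw [hsplit, Finset.sum_union]
  · congr 1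
    -- `a ↦ q − a` matches the upper half with the lower half
    refine Finset.sum_bij (fun a _ => q - a) ?_ ?_ ?_ ?_
    · intro a ha
      simp only [Finset.mem_filter, Finset.mem_Ioc, Finset.mem_range] at ha ⊢
      obtain ⟨⟨⟨ha0, haq⟩, hcop⟩, h2⟩ := ha
      exact ⟨by omega, by omega, (Nat.coprime_self_sub_left haq).2 hcop⟩
    · intro a ha b hb h
      simp only [Finset.mem_filter, Finset.mem_Ioc] at ha hb
      omega
    · intro b hb
      simp only [Finset.mem_filter, Finset.mem_range] at hb
      obtain ⟨hbq, h2, hcop⟩ := hb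
      have hb0 : b ≠ 0 := by
        rintro rfl
        rw [Nat.coprime_zero_left] at hcop
        omega
      refine ⟨q - b, ?_, by omega⟩
      simp only [Finset.mem_filter, Finset.mem_Ioc]
      exact ⟨⟨⟨by omega, by omega⟩, (Nat.coprime_self_sub_left hbq.le).2 hcop⟩, by omega⟩
    · intro a ha
      simp only [Finset.mem_filter, Finset.mem_Ioc] at ha
      rw [Nat.sub_sub_self ha.1.1.2]
  · rw [Finset.disjoint_left]
    intro a ha hb
    simp only [Finset.mem_filter, Finset.mem_range] at ha hb
    omega

/-- **`Σ_{1 ≤ a < q/2, (a,q)=1} (ζ(k, a/q) + ζ(k, 1 − a/q)) = J_k(q)·ζ(k)`** (`q ≥ 3`, `k ≥ 2`), with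
`J_k(q) = Σ_{d ∣ q} μ(d)(q/d)^k` — "`Σ_{(a,q)=1} ζ(k, a/q)` is a rational multiple of `ζ(k)`" (the converse half of
Proposition 2), via the pairing and `sum_coprime_hurwitzValue_eq`. [cite: GunRammurtyRath2011, proof of Proposition 2 (p. 1336)] -/
theorem sum_halfSystem_hurwitz_symm {q k : ℕ} (hq : 3 ≤ q) (hk : 2 ≤ k) :
    ∑ a ∈ (Finset.range q).filter (fun a => 2 * a < q ∧ a.Coprime q),
        (hurwitzValue k ((a : ℝ) / q) + hurwitzValue k (1 - (a : ℝ) / q)) =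
      ((∑ d ∈ q.divisors, (ArithmeticFunction.moebius d : ℤ) * ((q / d : ℕ) : ℤ) ^ k : ℤ) : ℝ) * zetaValue k := by
  rw [← sum_coprime_hurwitzValue_eq (by omega) hk,
    sum_coprime_eq_sum_halfSystem hq (fun a => hurwitzValue k ((a : ℝ) / q))]
  refine Finset.sum_congr rfl fun a ha => ?_
  simp only [Finset.mem_filter, Finset.mem_range] at ha
  have hq0 : (q : ℝ) ≠ 0 := by exact_mod_cast (show q ≠ 0 by omega)
  rw [Nat.cast_sub ha.1.le]
  field_simp

/-- For even `k = 2n ≥ 2`: the half-system total is a NON-ZERO rational multiple of `(2πi)^k`: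
`Σ_{1 ≤ a < q/2, (a,q)=1} (ζ(k, a/q) + ζ(k, 1 − a/q)) = β·(2πi)^k`, `β = J_k(q)·r_k·(−4)^{−n} ∈ ℚ^×` where
`ζ(k) = r_k π^k` (Euler). [cite: GunRammurtyRath2011, proof of Proposition 2 (p. 1336)] -/
theorem exists_rat_sum_halfSystem_eq_mul_two_pi_I_pow {q k : ℕ} (hq : 3 ≤ q) (hk : Even k) (hk2 : 2 ≤ k) :
    ∃ β : ℚ, β ≠ 0 ∧ ((∑ a ∈ (Finset.range q).filter (fun a => 2 * a < q ∧ a.Coprime q),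
        (hurwitzValue k ((a : ℝ) / q) + hurwitzValue k (1 - (a : ℝ) / q)) : ℝ) : ℂ) =
      (β : ℂ) * (2 * Real.pi * I) ^ k := by
  obtain ⟨n, hn⟩ := hk
  have hn' : k = 2 * n := by omega
  have hn0 : n ≠ 0 := by omega
  obtain ⟨r, hr⟩ := riemannZeta_two_mul_nat_mem_ratCast_mul_pi_pow hn0
  set J : ℤ := ∑ d ∈ q.divisors, (ArithmeticFunction.moebius d : ℤ) * ((q / d : ℕ) : ℤ) ^ k with hJ
  have hJpos : 0 < J := jordan_pos (by omega) hk2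
  have hzeta : ((zetaValue k : ℝ) : ℂ) = (r : ℂ) * (Real.pi : ℂ) ^ k := by
    rw [ofReal_zetaValue (by omega), hn']
    exact_mod_cast hr
  have hr0 : (r : ℂ) ≠ 0 := by
    intro h0
    have : ((zetaValue k : ℝ) : ℂ) = 0 := by rw [hzeta, h0, zero_mul]
    exact (zetaValue_pos_of_two_le hk2).ne' (by exact_mod_cast this)
  refine ⟨J * r * (-1) ^ n / 4 ^ n, ?_, ?_⟩
  · have hJ0 : (J : ℚ) ≠ 0 := by exact_mod_cast hJpos.ne'
    have hr0' : r ≠ 0 := by rintro rfl; exact hr0 (by simp)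
    exact div_ne_zero (mul_ne_zero (mul_ne_zero hJ0 hr0') (pow_ne_zero _ (by norm_num))) (pow_ne_zero _ (by norm_num))
  · rw [sum_halfSystem_hurwitz_symm hq hk2, ← hJ]
    push_cast
    have h2 : (2 * Real.pi * I : ℂ) ^ 2 = ((-1) * 4) * (Real.pi : ℂ) ^ 2 := by
      rw [mul_pow, mul_pow, Complex.I_sq]
      ring
    have hpow : (2 * Real.pi * I : ℂ) ^ k = (-1 : ℂ) ^ n * 4 ^ n * (Real.pi : ℂ) ^ k :=
      calc (2 * Real.pi * I : ℂ) ^ k = ((2 * Real.pi * I : ℂ) ^ 2) ^ n := by rw [hn', pow_mul]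
        _ = (((-1) * 4) * (Real.pi : ℂ) ^ 2) ^ n := by rw [h2]
        _ = (-1 : ℂ) ^ n * 4 ^ n * (Real.pi : ℂ) ^ k := by rw [mul_pow, mul_pow, ← pow_mul, ← hn']
    have hneg : ((-1 : ℂ) ^ n) ^ 2 = 1 := by
      rw [← pow_mul, mul_comm, pow_mul, neg_one_sq, one_pow]
    rw [hzeta, hpow, div_mul_eq_mul_div, eq_div_iff (pow_ne_zero _ (by norm_num : (4 : ℂ) ≠ 0))]
    linear_combination (-((J : ℂ) * (r : ℂ) * (Real.pi : ℂ) ^ k * 4 ^ n)) * hneg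

/-! ### Proposition 2 -/

/-- The half-system `{a < q : 2a < q, (a,q) = 1}` consists of units, pairwise distinct and never opposite mod `q` — the
hypotheses of the tree's `Okada.coeff_eq_zero`. [folklore] -/
private theorem halfSystem_hyps {q : ℕ} [NeZero q] (hq : 3 ≤ q) :
    (∀ a ∈ (Finset.range q).filter (fun a => 2 * a < q ∧ a.Coprime q), IsUnit ((a : ℕ) : ZMod q)) ∧
    (∀ a ∈ (Finset.range q).filter (fun a => 2 * a < q ∧ a.Coprime q),
      ∀ a' ∈ (Finset.range q).filter (fun a => 2 * a < q ∧ a.Coprime q), ((a : ℕ) : ZMod q) = (a' : ℕ) → a = a') ∧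
    (∀ a ∈ (Finset.range q).filter (fun a => 2 * a < q ∧ a.Coprime q),
      ∀ a' ∈ (Finset.range q).filter (fun a => 2 * a < q ∧ a.Coprime q), ((a : ℕ) : ZMod q) ≠ -((a' : ℕ) : ZMod q)) := by
  refine ⟨fun a ha => ?_, fun a ha a' ha' h => ?_, fun a ha a' ha' h => ?_⟩
  · simp only [Finset.mem_filter, Finset.mem_range] at ha
    exact (ZMod.isUnit_iff_coprime a q).mpr ha.2.2
  · simp only [Finset.mem_filter, Finset.mem_range] at ha ha'
    rw [ZMod.natCast_eq_natCast_iff] at h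
    exact Nat.ModEq.eq_of_lt_of_lt h ha.1 ha'.1
  · simp only [Finset.mem_filter, Finset.mem_range] at ha ha'
    have ha0 : a ≠ 0 := by
      rintro rfl
      have := ha.2.2
      rw [Nat.coprime_zero_left] at this
      omega
    have hsum0 : (((a + a' : ℕ)) : ZMod q) = 0 := by
      push_cast
      rw [h]
      ring
    rw [ZMod.natCast_eq_zero_iff] at hsum0
    have := Nat.le_of_dvd (by omega) hsum0
    omega

/-- **The core of Proposition 2** (complex form): if rational `c_a` and `α` satisfy
`Σ_{1 ≤ a < q/2, (a,q)=1} c_a (ζ(k,a/q) + ζ(k,1−a/q)) = α·(2πi)^k` (`k` even, `q ≥ 3`), then all the `c_a` are equal —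
to `α/β` where `β·(2πi)^k` is the half-system total: the differences `c_a − α/β` satisfy the HOMOGENEOUS twisted
relations (`relation_transport_const` for `c` and for the constant family `1`), hence vanish by Okada
(`Okada.coeff_eq_zero`) — "`(ℤ/qℤ)^×/±1` acts transitively … linearly independent … all the `c_a`'s are necessarily
equal". [cite: GunRammurtyRath2011, Proposition 2 and its proof (pp. 1335–1336)] -/
theorem halfSystem_coeff_eq_const {q k : ℕ} [NeZero q] (hq : 3 ≤ q) (hk : Even k) (hk2 : 2 ≤ k) (c : ℕ → ℚ) (α : ℚ)
    (h : ∑ a ∈ (Finset.range q).filter (fun a => 2 * a < q ∧ a.Coprime q), (c a : ℂ) *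
        (hurwitzZeta (ZMod.toAddCircle ((a : ℕ) : ZMod q)) k +
          (-1 : ℂ) ^ k * hurwitzZeta (ZMod.toAddCircle (-((a : ℕ) : ZMod q))) k) = (α : ℂ) * (2 * Real.pi * I) ^ k) :
    ∃ c₀ : ℚ, ∀ a ∈ (Finset.range q).filter (fun a => 2 * a < q ∧ a.Coprime q), c a = c₀ := by
  obtain ⟨β, hβ0, hβ⟩ := exists_rat_sum_halfSystem_eq_mul_two_pi_I_pow hq hk hk2
  -- the total, in complex form, is the relation with the constant family `1`
  have hone : ∑ a ∈ (Finset.range q).filter (fun a => 2 * a < q ∧ a.Coprime q), ((1 : ℚ) : ℂ) *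
      (hurwitzZeta (ZMod.toAddCircle ((a : ℕ) : ZMod q)) k +
        (-1 : ℂ) ^ k * hurwitzZeta (ZMod.toAddCircle (-((a : ℕ) : ZMod q))) k) = (β : ℂ) * (2 * Real.pi * I) ^ k := by
    rw [← hβ, Complex.ofReal_sum]
    refine Finset.sum_congr rfl fun a ha => ?_
    simp only [Finset.mem_filter, Finset.mem_range] at ha
    rw [Rat.cast_one, one_mul, ← Okada.ofReal_hurwitz_symm hk2 ha.1.le, Even.neg_one_pow hk, one_mul]
    rfl
  obtain ⟨hunit, hinj, hneg⟩ := halfSystem_hyps hq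
  refine ⟨α / β, fun a₀ ha₀ => ?_⟩
  -- the differences satisfy the homogeneous twisted relations
  have htw : ∀ t : ℕ, t.Coprime q → ∑ a ∈ (Finset.range q).filter (fun a => 2 * a < q ∧ a.Coprime q),
      ((c a - α / β : ℚ) : ℂ) * (hurwitzZeta (ZMod.toAddCircle (((a : ℕ) : ZMod q) * (t : ZMod q))) k +
        (-1 : ℂ) ^ k * hurwitzZeta (ZMod.toAddCircle (-(((a : ℕ) : ZMod q) * (t : ZMod q)))) k) = 0 := by
    intro t ht
    have h1 := relation_transport_const hk2 _ c (fun a : ℕ => ((a : ℕ) : ZMod q)) α h ht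
    have h2 := relation_transport_const hk2 _ (fun _ : ℕ => (1 : ℚ)) (fun a : ℕ => ((a : ℕ) : ZMod q)) β hone ht
    have hβC : (β : ℂ) ≠ 0 := by exact_mod_cast hβ0
    have hsplit : ∑ a ∈ (Finset.range q).filter (fun a => 2 * a < q ∧ a.Coprime q),
        ((c a - α / β : ℚ) : ℂ) * (hurwitzZeta (ZMod.toAddCircle (((a : ℕ) : ZMod q) * (t : ZMod q))) k +
          (-1 : ℂ) ^ k * hurwitzZeta (ZMod.toAddCircle (-(((a : ℕ) : ZMod q) * (t : ZMod q)))) k) =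
        (∑ a ∈ (Finset.range q).filter (fun a => 2 * a < q ∧ a.Coprime q),
          (c a : ℂ) * (hurwitzZeta (ZMod.toAddCircle (((a : ℕ) : ZMod q) * (t : ZMod q))) k +
            (-1 : ℂ) ^ k * hurwitzZeta (ZMod.toAddCircle (-(((a : ℕ) : ZMod q) * (t : ZMod q)))) k)) -
        ((α / β : ℚ) : ℂ) * ∑ a ∈ (Finset.range q).filter (fun a => 2 * a < q ∧ a.Coprime q),
          ((1 : ℚ) : ℂ) * (hurwitzZeta (ZMod.toAddCircle (((a : ℕ) : ZMod q) * (t : ZMod q))) k +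
            (-1 : ℂ) ^ k * hurwitzZeta (ZMod.toAddCircle (-(((a : ℕ) : ZMod q) * (t : ZMod q)))) k) := by
      rw [Finset.mul_sum, ← Finset.sum_sub_distrib]
      refine Finset.sum_congr rfl fun a _ => ?_
      push_cast
      ring
    rw [hsplit, h1, h2]
    push_cast
    rw [← mul_assoc, div_mul_cancel₀ _ hβC, sub_self]
  have := Okada.coeff_eq_zero hk2 _ (fun a => c a - α / β) (fun a : ℕ => ((a : ℕ) : ZMod q)) hunit hinj hneg htw a₀ ha₀
  linear_combination this

/-- **Gun–Murty–Rath 2011, Proposition 2 (second part).** For even `k > 1` and `q ≥ 3`, with rational coefficients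
`c_a` on the half-system `1 ≤ a < q/2`, `(a, q) = 1`: `Σ_a c_a Z_k(a,q) ∈ ℚ` iff all the `c_a` are equal — typed with
`Z_k(a,q)·(2πi)^k = ζ(k,a/q) + ζ(k,1−a/q)` over the tree's real `hurwitzValue` and "`∈ ℚ·π^k`" in place of
"`∈ ℚ·(2πi)^k`" (the same thing for even `k`). [cite: GunRammurtyRath2011, Proposition 2 (p. 1335)] -/
theorem sum_halfSystem_smul_mem_rat_iff {q k : ℕ} (hq : 3 ≤ q) (hk : Even k) (hk2 : 2 ≤ k) (c : ℕ → ℚ) :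
    (∃ α : ℚ, ∑ a ∈ (Finset.range q).filter (fun a => 2 * a < q ∧ a.Coprime q),
        (c a : ℝ) * (hurwitzValue k ((a : ℝ) / q) + hurwitzValue k (1 - (a : ℝ) / q)) = α * Real.pi ^ k) ↔
      ∃ c₀ : ℚ, ∀ a ∈ (Finset.range q).filter (fun a => 2 * a < q ∧ a.Coprime q), c a = c₀ := by
  haveI : NeZero q := ⟨by omega⟩
  obtain ⟨n, hn⟩ := hk
  have hn' : k = 2 * n := by omega
  -- `π^k = (2πi)^k / ((−1)^n 4^n)`
  have hpow : (2 * Real.pi * I : ℂ) ^ k = (-1 : ℂ) ^ n * 4 ^ n * (Real.pi : ℂ) ^ k := by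
    have h2 : (2 * Real.pi * I : ℂ) ^ 2 = ((-1) * 4) * (Real.pi : ℂ) ^ 2 := by
      rw [mul_pow, mul_pow, Complex.I_sq]
      ring
    calc (2 * Real.pi * I : ℂ) ^ k = ((2 * Real.pi * I : ℂ) ^ 2) ^ n := by rw [hn', pow_mul]
      _ = (((-1) * 4) * (Real.pi : ℂ) ^ 2) ^ n := by rw [h2]
      _ = (-1 : ℂ) ^ n * 4 ^ n * (Real.pi : ℂ) ^ k := by rw [mul_pow, mul_pow, ← pow_mul, ← hn']
  have hu : ((-1 : ℂ) ^ n * 4 ^ n) ≠ 0 := mul_ne_zero (pow_ne_zero _ (by norm_num)) (pow_ne_zero _ (by norm_num))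
  constructor
  · rintro ⟨α, hα⟩
    refine halfSystem_coeff_eq_const hq ⟨n, hn⟩ hk2 c (α * (-1) ^ n / 4 ^ n) ?_
    have hC : ∑ a ∈ (Finset.range q).filter (fun a => 2 * a < q ∧ a.Coprime q), (c a : ℂ) *
        (hurwitzZeta (ZMod.toAddCircle ((a : ℕ) : ZMod q)) k +
          (-1 : ℂ) ^ k * hurwitzZeta (ZMod.toAddCircle (-((a : ℕ) : ZMod q))) k) = (α : ℂ) * (Real.pi : ℂ) ^ k := by
      have h0 := congrArg (fun x : ℝ => (x : ℂ)) hα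
      simp only [Complex.ofReal_sum, Complex.ofReal_mul, Complex.ofReal_ratCast, Complex.ofReal_pow] at h0
      rw [← h0]
      refine Finset.sum_congr rfl fun a ha => ?_
      rw [← Okada.ofReal_hurwitz_symm hk2 (by have := (Finset.mem_filter.1 ha).2.1; omega : a ≤ q),
        Even.neg_one_pow ⟨n, hn⟩, one_mul]
      rfl
    have hneg' : ((-1 : ℂ) ^ n) ^ 2 = 1 := by rw [← pow_mul, mul_comm, pow_mul, neg_one_sq, one_pow]
    rw [hC, hpow]
    push_cast
    field_simp
    linear_combination (-(α : ℂ)) * hneg'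
  · rintro ⟨c₀, hc₀⟩
    obtain ⟨β, -, hβ⟩ := exists_rat_sum_halfSystem_eq_mul_two_pi_I_pow hq ⟨n, hn⟩ hk2
    have hT : ∑ a ∈ (Finset.range q).filter (fun a => 2 * a < q ∧ a.Coprime q),
        (hurwitzValue k ((a : ℝ) / q) + hurwitzValue k (1 - (a : ℝ) / q)) =
          ((β * (-1) ^ n * 4 ^ n : ℚ) : ℝ) * Real.pi ^ k := by
      apply Complex.ofReal_injective
      rw [hβ, hpow]
      push_cast
      ring
    refine ⟨c₀ * (β * (-1) ^ n * 4 ^ n), ?_⟩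
    rw [Finset.sum_congr rfl fun a ha => by rw [hc₀ a ha], ← Finset.mul_sum, hT]
    push_cast
    ring

/-- The half-system has `φ(q)/2` elements. [cite: GunRammurtyRath2011, §1 (p. 1332)] -/
theorem card_halfSystem_filter {q : ℕ} (hq : 3 ≤ q) :
    ((Finset.range q).filter (fun a => 2 * a < q ∧ a.Coprime q)).card = Nat.totient q / 2 := by
  rw [← card_halfSystem_eq hq]
  congr 1
  ext a
  simp only [Finset.mem_filter, Finset.mem_range, Nat.coprime_comm]
  tauto

/-- **Gun–Murty–Rath 2011, Proposition 2 (first part).** For even `k > 1`, `q` with `φ(q) ≥ 4`, and `a` in the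
half-system: `Z_k(a,q) ∉ ℚ`, i.e. `(ζ(k,a/q) + ζ(k,1−a/q))/π^k` is irrational (it lies in `ℚ(ζ_q)`:
`ChowlaMilnorEvenProofs.hurwitzEven_mem_cyclotomic`). [cite: GunRammurtyRath2011, Proposition 2 (p. 1335)] -/
theorem irrational_hurwitz_symm_div_pi_pow {q k a : ℕ} (hq : 3 ≤ q) (hφ : 4 ≤ Nat.totient q) (hk : Even k)
    (hk2 : 2 ≤ k) (ha : a ∈ (Finset.range q).filter (fun a => 2 * a < q ∧ a.Coprime q)) :
    Irrational ((hurwitzValue k ((a : ℝ) / q) + hurwitzValue k (1 - (a : ℝ) / q)) / Real.pi ^ k) := by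
  rintro ⟨ρ, hρ⟩
  have hpi : Real.pi ^ k ≠ 0 := pow_ne_zero _ Real.pi_ne_zero
  have hrel : ∑ b ∈ (Finset.range q).filter (fun a => 2 * a < q ∧ a.Coprime q),
      ((if b = a then (1 : ℚ) else 0 : ℚ) : ℝ) * (hurwitzValue k ((b : ℝ) / q) + hurwitzValue k (1 - (b : ℝ) / q)) =
        ρ * Real.pi ^ k := by
    simp only [apply_ite ((↑) : ℚ → ℝ), Rat.cast_one, Rat.cast_zero, ite_mul, one_mul, zero_mul,
      Finset.sum_ite_eq', if_pos ha]
    rw [hρ, div_mul_cancel₀ _ hpi]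
  obtain ⟨c₀, hc₀⟩ := (sum_halfSystem_smul_mem_rat_iff hq hk hk2 _).1 ⟨ρ, hrel⟩
  have hcard : 1 < ((Finset.range q).filter (fun a => 2 * a < q ∧ a.Coprime q)).card := by
    rw [card_halfSystem_filter hq]
    omega
  obtain ⟨b, hb, hba⟩ := Finset.exists_mem_ne hcard a
  have h1 := hc₀ a ha
  have h2 := hc₀ b hb
  rw [if_pos rfl] at h1
  rw [if_neg hba] at h2
  linarith [h1, h2]

end Literature.NumberTheory.Irrationality.DirichletLValues

end
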